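import Summits.CriticalPhenomena.PercolationContinuityZ3.Theorems.PercNearOneGluingNoHeavyQuantOneArmTwoEventually
import Summits.CriticalPhenomena.PercolationContinuityZ3.Theorems.PercAnnulusCrossingSetToSetHighDimAspect
import HarnessLib

/-!
# PAPER-2 track, ARM-3 gen 11: ABOVE SIX DIMENSIONS THE EXACT TWO-POINT ⟹ ONE-ARM EXPONENT MAP FAILS, and the gluing input (A2)□ is
# independent of the landmark (companion of `…QuantLandmarkHyperscalingExact.lean`)

builds on p205010 (kernel theorem, internal audit signed; external expert review pending) — NOT used in this file.

Seat `prim-quant-arm-3` (gen 11), `--supports stmt-CriticalPhenomena-4575 --as helper`; pure proofs, no definitions, no named facts, no sorries.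
Notation: (T1)_c = `Quant.OneArmPolyDecayAtCritical d c C` (`π_{p_c}(n) ≤ C n^{−c}`), X_A(a): `Σ_{z∈Λ_R} τ_{p_c}(0,z) ≤ K R^{d−a}` (`R ≥ 1`),
(A2)□ = `Crossing.SetToSetQuasiMultAspectAt d p_c s L ϰ` (Basu–Sapozhnikov's set-to-set quasi-multiplicativity at one aspect).

Part 1 (`…QuantLandmarkHyperscalingExact.lean`, p306603) shows that UNDER (A2)□ a ball two-point saving X_A(a) gives (T1)_{a/2} — the
hyperscaling value `2/ρ = d − 2 + η` — whereas the kernel's unconditional transfer `Quant.oneArmPolyDecayAtCritical_of_ballTwoPoint`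
(Harris-squared gluing through the Duminil-Copin–Kozma–Tassion uniqueness zone) gives only `c = dktAlpha d · min(a,1)/2`.  This file shows the
loss is STRUCTURAL:

* **`ballTwoPoint_and_not_oneArmPolyDecayAtCritical_half_eventually`** — there is `d₀ > 6` such that for every `d ≥ d₀`: X_A(d−2) HOLDS
  (`τ_{p_c}(x,y) ≤ C‖x−y‖^{2−d}`, the tree's `twoPointBoundedRatio_eventually` = Hara–Slade 1990 + Hara 2008, summed by Kozma–Nachmias's box sum
  `sum_tau_box_le_near`) and (T1)_{(d−2)/2} FAILS for every constant (`π_{p_c}(n) ≥ c/n²`, `rhoExHalf_eventually` = Kozma–Nachmias 2011; and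
  `(d−2)/2 > 2`).  So NO dimension-uniform argument can improve the unconditional map to `c = a/2`: exactness needs an input that fails above
  six dimensions — (A2)□ is one (`Crossing.exists_forall_not_setToSetQuasiMultAspectAt_criticalProbI`, lane 3), as is every bounded-aspect
  crossing defect (`Quant.not_scaleDefectAt_allAspects_eventually`).  This is the two-point-entrance analogue of the barrier BC8 recorded for
  route (i) in the lane's executive (§5): the landmark survives above six dimensions, its low-dimensional exponent bookkeeping does not.
* **`oneArmPolyDecay_and_not_setToSetQuasiMultAspectAt_eventually`** — for all large `d`, `OneArmPolyDecay d` holds (exponent `2`) while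
  (A2)□ fails at every aspect: the gluing input is NOT implied by the landmark (d-uniformly); it enters only through the exponent maps.

HONEST READING.  Two conjunctions of tree theorems (all for `d ≥ d₀`, `d₀` Hara–Slade's non-explicit threshold; the explicit `d ≥ 10⁵⁰` versions
exist in the catalogue and are not repeated); nothing about `3 ≤ d ≤ 6` is proved here beyond the moral that the missing input must be
dimension-sensitive; nothing is a rate; the lane's honest sentence (log* class) is unchanged.

References: G. Kozma, A. Nachmias, J. Amer. Math. Soc. 24 (2011) 375–409, Thm. 1, Lemma 2.1 [KozmaNachmias2011]; T. Hara, Ann. Probab. 36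
(2008) 530–593, Thm. 1.1 [Hara2008]; T. Hara, G. Slade, Comm. Math. Phys. 128 (1990) 333–391 [HaraSlade1990]; D. Basu, A. Sapozhnikov,
ECP 22 (2017) no. 26, §1 [BasuSapozhnikov2017ECP]; M. Heydenreich, R. van der Hofstad (2017), Thm. 11.5, Open Problem 10.1
[HeydenreichVanDerHofstad2017].
-/

noncomputable section

namespace Summit.CriticalPhenomena.PercolationContinuityZ3.Theorems.Quant

open MeasureTheory Finset Filter Literature.Probability.Percolation Literature.Probability.LatticeModels
open Summit.CriticalPhenomena.PercolationContinuityZ3.Theorems.Crossing (SetToSetQuasiMultAspectAt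
  exists_forall_not_setToSetQuasiMultAspectAt_criticalProbI)
open Literature.Barriers.CriticalPhenomena (TwoPointBoundedRatio twoPointBoundedRatio_eventually rhoExHalf_eventually
  sum_tau_box_le_near)
open scoped Classical

variable {d : ℕ}

/-! ## §5. Above six dimensions the exact map fails; (A2)□ is independent of the landmark -/

/-- **ABOVE SIX DIMENSIONS, X_A(d−2) HOLDS AND (T1)_{(d−2)/2} FAILS** — kernel, no named fact: there is `d₀ > 6` such that for
every `d ≥ d₀`, (i) `∃ K, ∀ R ≥ 1, Σ_{z∈Λ_R} τ_{p_c}(0,z) ≤ K R^{d−(d−2)}` (the bounded-ratio two-point function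
`τ_{p_c}(x,y) ≤ C‖x−y‖^{2−d}`, `twoPointBoundedRatio_eventually` = Hara–Slade 1990 + Hara 2008, summed by Kozma–Nachmias's box sum
`sum_tau_box_le_near`), and (ii) `¬ OneArmPolyDecayAtCritical d ((d−2)/2) C` for every `C` (`π_{p_c}(n) ≥ c/n²`, `rhoExHalf_eventually`
= Kozma–Nachmias 2011, and `(d−2)/2 > 2`; `Quant.oneArmPolyDecayAtCritical_exponent_le_two_of_rhoExHalf`).  So the exact map
X_A(a) ⟹ (T1)_{a/2} of part 1 (there under (A2)□) is FALSE d-uniformly: the `α_d`-loss of the unconditional transfer is the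
signature of a missing dimension-sensitive input. [cite: KozmaNachmias2011, Thm. 1 and Lemma 2.1 (proof)] [cite: Hara2008, Thm. 1.1]
[cite: HeydenreichVanDerHofstad2017, Thm. 11.5 (11.3.2)] -/
theorem ballTwoPoint_and_not_oneArmPolyDecayAtCritical_half_eventually :
    ∃ d₀ : ℕ, 6 < d₀ ∧ ∀ d : ℕ, d₀ ≤ d →
      (∃ K : ℝ, ∀ R : ℕ, 1 ≤ R →
          ∑ z ∈ box d R, tau d (criticalProbI d) 0 z ≤ K * (R : ℝ) ^ ((d : ℝ) - ((d : ℝ) - 2))) ∧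
        ∀ C : ℝ, ¬ OneArmPolyDecayAtCritical d (((d : ℝ) - 2) / 2) C := by
  obtain ⟨D₁, hD₁, hτ⟩ := twoPointBoundedRatio_eventually
  obtain ⟨D₂, hD₂, hρ⟩ := rhoExHalf_eventually
  refine ⟨max D₁ D₂, lt_max_of_lt_left hD₁, fun d hd => ⟨?_, ?_⟩⟩
  · have hd1 : D₁ ≤ d := (le_max_left _ _).trans hd
    have hd2 : 2 ≤ d := by omega
    obtain ⟨C', C, hC', hC'C, hb⟩ := (hτ d hd1).natPow hd2
    have hC : 0 ≤ C := (hC'.trans_le hC'C).le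
    have hU : ∀ x y : Site d, x ≠ y → tau d (criticalProbI d) x y ≤ C * (‖x - y‖ ^ (d - 2))⁻¹ :=
      fun x y hxy => (hb x y hxy).2
    refine ⟨1 + C * (2 * d * 3 ^ (d - 1) * 36), fun R hR => ?_⟩
    have hR0 : (0 : ℝ) < R := by exact_mod_cast hR
    have h0 : (0 : Site d) ∈ box d (4 * R) := by simp [mem_box]
    have hnear := sum_tau_box_le_near (criticalProbI d) hd2 hC hU (n := R) h0
    have hsub : ∑ z ∈ box d R, tau d (criticalProbI d) 0 z ≤ ∑ z ∈ box d (2 * R), tau d (criticalProbI d) 0 z :=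
      Finset.sum_le_sum_of_subset_of_nonneg (box_mono d (by omega)) fun z _ _ => tau_nonneg _ 0 z
    have hexp : (R : ℝ) ^ ((d : ℝ) - ((d : ℝ) - 2)) = (R : ℝ) ^ 2 := by
      rw [sub_sub_cancel, show (2 : ℝ) = ((2 : ℕ) : ℝ) by norm_num, Real.rpow_natCast]
    have h6 : (((6 * R : ℕ) : ℝ)) ^ 2 = 36 * (R : ℝ) ^ 2 := by push_cast; ring
    have hR1 : (1 : ℝ) ≤ (R : ℝ) ^ 2 := by nlinarith [show (1 : ℝ) ≤ R by exact_mod_cast hR]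
    have hK0 : 0 ≤ C * (2 * d * 3 ^ (d - 1) * 36 : ℝ) := by positivity
    rw [hexp]
    calc ∑ z ∈ box d R, tau d (criticalProbI d) 0 z ≤ 1 + C * (2 * d * 3 ^ (d - 1) * (((6 * R : ℕ) : ℝ)) ^ 2) :=
          hsub.trans hnear
      _ = 1 + C * (2 * d * 3 ^ (d - 1) * 36) * (R : ℝ) ^ 2 := by rw [h6]; ring
      _ ≤ (1 + C * (2 * d * 3 ^ (d - 1) * 36)) * (R : ℝ) ^ 2 := by nlinarith
  · intro C h
    have hd2 : D₂ ≤ d := (le_max_right _ _).trans hd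
    have h2 := oneArmPolyDecayAtCritical_exponent_le_two_of_rhoExHalf (hρ d hd2) h
    have hd6 : (6 : ℝ) < d := by exact_mod_cast (lt_of_lt_of_le (lt_max_of_lt_left hD₁) hd)
    linarith

/-- **THE LANDMARK DOES NOT IMPLY THE GLUING INPUT** — kernel, no named fact: there is `d₀` such that for every `d ≥ d₀`,
`OneArmPolyDecay d` HOLDS (Kozma–Nachmias: exponent `2`, `Quant.oneArmPolyDecayAtCritical_two_eventually`) while (A2)□ FAILS at every aspect
`(s, L)`, `s ≥ 1`, every `ϰ > 0` (lane 3, `Crossing.exists_forall_not_setToSetQuasiMultAspectAt_criticalProbI`).  (A2)□ is thus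
logically independent of (T1) as a dimension-uniform statement; it enters the landmark only through the exponent maps.
[cite: KozmaNachmias2011, Thm. 1] [cite: BasuSapozhnikov2017ECP, §1 (A2) ("we believe (A2) holds iff d < 6")] -/
theorem oneArmPolyDecay_and_not_setToSetQuasiMultAspectAt_eventually :
    ∃ d₀ : ℕ, ∀ d : ℕ, d₀ ≤ d →
      OneArmPolyDecay d ∧ ∀ s L : ℕ, 1 ≤ s → ∀ ϰ : ℝ, 0 < ϰ → ¬ SetToSetQuasiMultAspectAt d (criticalProbI d) s L ϰ := by
  obtain ⟨D₁, -, h1⟩ := oneArmPolyDecayAtCritical_two_eventually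
  obtain ⟨D₂, h2⟩ := exists_forall_not_setToSetQuasiMultAspectAt_criticalProbI
  refine ⟨max D₁ D₂, fun d hd => ⟨?_, fun s L hs ϰ hϰ => h2 d ((le_max_right _ _).trans hd) s L hs ϰ hϰ⟩⟩
  obtain ⟨C, hC⟩ := h1 d ((le_max_left _ _).trans hd)
  exact ⟨2, by norm_num, C, hC⟩

end Summit.CriticalPhenomena.PercolationContinuityZ3.Theorems.Quant
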